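import Literature.NumberTheory.Rogawski1990.ArchOrbFamGExtCornerReaders   -- ★ (X3-CORE) (this seat): §2 `ℓ^∞` bounded families (`iteratedDeriv` sockets), §3 slices; brings ★ (E1) `exists_forall_norm_iteratedFDeriv_lineReader_le_of_uniform_on` (F0P3a-p08) + ★ (B2) §1
import Literature.Analysis.Calculus.ParametricFamilyLocalisation             -- ★ (F0P3a-p04 (g24)): `fderiv_slice_fst_apply_of_prod`, `contDiffOn_uncurry_fderiv_apply_of_isOpen`, `fderiv_apply_eq_zero_of_forall_mem_isOpen` (open-class calculus)
import HarnessLib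

/-!
# (I₁) AT A CROSS-PLACE CORNER — the PEELING INDUCTION over `Fin m`: an `m`-fold nested reader of a jointly smooth, compactly supported block function is smooth off the
# `m` walls with every jet bounded on `K ×ˢ (T ∩ T₀)^m` (Varadarajan 1977 I §1.12; Bouaziz 1994 §3.1 (I₁)–(I₂); Hörmander ALPDO I §1.1, §2.1)

Topic `NumberTheory/Rogawski1990`; namespace `Literature.Analysis.Calculus` (generic).  THEOREMS ONLY (no `def`, no instance, no notation, no axiom, no named fact, no `sorry`).  Cell
`pub/hodgecm-mathlib`, crux H413 (`stmt-HodgeConjecture-24833`), F0∕P3c line LH3 (closer stub `stub_N9`, DIRECT ROAD), LETTER L1 clause (I₁), organ **O-L1e `stub_N9hcCrossCornerJetBounds`**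
(X′-CORNERS) of leaf `F0_P3c_StubN9Direct` v5 (LH3-plan (g4) RULING #18): brick **(X3-asm) «PEELING OVER `Fin m`»** (binder of record F0P3a-p02 (g21), 2026-09-02T11:01Z); consumes ★ (X3-CORE)
`ArchOrbFamGExtCornerReaders` (this seat); its hypotheses `hunif`∕`hread` are discharged by (X3-rk1) (F0P3a-p04 (g24): fixed-interval (ELL-∞-UNIF) on the `U(J)`-Cayley carrier at
`E′ = ℓ^∞`, open-parameter reader data ★ `ArchRankOneOrbitalFamilyParamOpen`), its functional tower `H` by the `Measure.pi` Fubini junction over (X2)'s `m`-block descent box (LH3-p04 (g4)).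
Count-neutral.

THE MATHEMATICS.  Fix a «rank-one functional» `Φ : (M → E) → ℝ → E` on block test functions (`M` finite-dimensional — the `U(1,1)` block `M₂(ℂ)`; `E` complete), an open set `T ⊆ ℝ` of
REGULAR normal parameters (`sin ψ ≠ 0`) and a set `T₀` (a compact interval around the wall `ψ = 0`), with the two properties the rank-one elliptic orbital integral has:
* `hunif` — (ELL-∞-UNIF) on the fixed set `T ∩ T₀` at EVERY `E′ = ℓ^∞(J, E)`: for `G ∈ C_c^∞(M, ℓ^∞(J, E))` one `B` with `‖(Φ (ℓ ∘ G))⁽ⁿ⁾ ψ‖ ≤ ‖ℓ‖ · B` (`ψ ∈ T ∩ T₀`, all CLMs `ℓ`);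
* `hread` — reader data on OPEN parameter sets: for every finite-dimensional `P′`, open `O ⊆ P′` and family `g : P′ → M → E` smooth on `O ×ˢ univ` with one compact `X`-support, the
  reader `z ↦ Φ (g z.1) z.2` is smooth on `O ×ˢ T` and `∂_{(v,0)}` of it is the reader of the parameter derivative `q ↦ X ↦ ∂_v (q′ ↦ g q′ X) q`.
Let `H m P′ : (P′ × (Fin m → M) → E) → (P′ × (Fin m → ℝ) → E)` be ANY tower of «`m`-fold nested readers» — `H 0 f (q, ·) = f (q, ·)`, and PEELING
`H (m+1) f (q, ψ) = Φ (X₀ ↦ H m f̃ ((q, X₀), Fin.tail ψ)) (ψ 0)` with `f̃ ((q, X₀), X′) = f (q, Fin.cons X₀ X′)` (the outermost block integrated last; the Fubini identity of the `m`-fold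
`Measure.pi` integral of (X2)), and `H m f (q, ψ) = 0` whenever `f (q, ·) ≡ 0`.  THEN (**`contDiffOn_and_forall_bound_nestedReader`**, by induction on `m`, the parameter space growing
by one block factor `M` at each peeling): for every finite-dimensional `P`, open `Q ⊆ P`, `f : P × (Fin m → M) → E` smooth on `Q ×ˢ univ` vanishing when some block variable leaves a
compact `C`, and compact `K ⊆ Q`:
  (I₂)-part `ContDiffOn ℝ ∞ (H m f) (Q ×ˢ T^m)` and (I₁)-part `∀ n, ∃ B, ∀ z ∈ K ×ˢ (T ∩ T₀)^m, ‖Dⁿ (H m f) z‖ ≤ B`.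
The step: by induction `H m f̃` (parameters `P × M`, compact `K ×ˢ C`) is smooth off the inner walls with jets bounded on `(K ×ˢ C) ×ˢ (T ∩ T₀)^m` and vanishes for `X₀ ∉ C`; so the
family `g (q, ψ′) := X₀ ↦ H m f̃ ((q, X₀), ψ′)` over the OPEN parameter set `O = Q ×ˢ T^m` is smooth on `O ×ˢ univ`, supported in `C`, with JOINTLY bounded jets on `(S ∩ O) ×ˢ univ`,
`S = K ×ˢ T₀^m` — the admissible class `Adm_{O,S}` (closed under the parameter derivatives: smoothness and support by ★ `contDiffOn_uncurry_fderiv_apply_of_isOpen` ∕ `fderiv_apply_eq_zero_of_forall_mem_isOpen` (F0P3a-p04), bounds by §1 `‖Dᵏ(∂_v G)‖ ≤ ‖v‖ ‖Dᵏ⁺¹ G‖`); ★ (X3-CORE) §3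
makes its members a `C^∞`-bounded family, ★ §2 (with `hunif` at `J = ↥(S ∩ O)`) gives the uniform normal-jet bound `hbd`, ★ §1 bounds every jet of the reader on `(S ∩ O) ×ˢ (T ∩ T₀)`,
and the linear re-indexing `(q, ψ) ↦ ((q, Fin.tail ψ), ψ 0)` carries this to `K ×ˢ (T ∩ T₀)^{m+1}` (★ (B2) §1 pull-back).
The corner consumer: with `m` = the number of coincidence places of the (X′) point, `H m f` = the dressed `m`-block descent of `e^{ρ} · orbFamGExt` ((X2) + Fubini), this is the `hH₂s`∕`hH₂b`
input of ★ (X1) `exists_nhds_bddAbove_norm_iteratedFDeriv_orbFamGExt_of_multiWallProductModel_cube`, i.e. organ O-L1e.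
HONEST LABEL: generic calculus (no orbital integral, no descent, no Fubini inside — those are (X3-rk1), (X2) and the junction); the compact-SCALAR corners (O-L1d) are a different
organ; HC_CM is proved only modulo the 7 printed citations (2 remaining: hLiu418 = `stmt-HodgeConjecture-24832`, h413 = `stmt-HodgeConjecture-24833`) until rung 0 closes; this file
moves no row of the books.

## References
* [Varadarajan1977] V. S. Varadarajan, *Harmonic Analysis on Real Reductive Groups*, LNM 576 (1977), Part I §1.12 (`'F_f`: bounded derivatives on `T_{in-reg}`), Part I §3.
* [Bouaziz1994IntegralesOrbitales] A. Bouaziz, *Intégrales orbitales sur les groupes de Lie réductifs*, Ann. Sci. ÉNS 27 (1994), §3.1 (I₁)–(I₂) p. 579, §3.2 p. 580.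
* [HormanderALPDO1] L. Hörmander, *The Analysis of Linear Partial Differential Operators I*, 2nd ed. (1990), §1.1 Thm. 1.1.8, (1.1.9); §2.1.
* [Shelstad1979] D. Shelstad, *Characters and inner forms of a quasi-split group over ℝ*, Compositio Math. 39 (1979), §4 pp. 22–25.
-/

set_option autoImplicit false

noncomputable section

open Set Filter Topology Function
open scoped ContDiff ENNReal

namespace Literature.Analysis.Calculus

open Literature.NumberTheory.Rogawski1990

/-! ## §1 Generic jet bookkeeping: jets vanish where the function vanishes nearby; joint jet bounds pass to the parameter-derivative family -/

section Generic

variable {V F : Type*} [NormedAddCommGroup V] [NormedSpace ℝ V] [NormedAddCommGroup F] [NormedSpace ℝ F]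

/-- **Jets vanish at a point near which the function vanishes** (Mathlib `Filter.EventuallyEq.iteratedFDeriv` + `iteratedFDeriv_fun_zero`; public so that the mixed-corner
consumer (F0P3a-p08 (g23), (E4′)) can cite it). [cite: HormanderALPDO1, §1.1 (1.1.8)] -/
theorem iteratedFDeriv_eq_zero_of_eventuallyEq_zero {f : V → F} {x : V} (h : f =ᶠ[𝓝 x] fun _ => 0) (k : ℕ) : iteratedFDeriv ℝ k f x = 0 := by
  rw [(h.iteratedFDeriv ℝ k).eq_of_nhds, iteratedFDeriv_fun_zero]
  rfl

/-- Jets of a directional derivative against the next full jet (open-set form; private helper). [folklore] [cite: HormanderALPDO1, §1.1 Thm. 1.1.8] -/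
private theorem norm_iteratedFDeriv_fderiv_apply_le_aux {G : V → F} {U : Set V} (hU : IsOpen U) (hG : ContDiffOn ℝ ∞ G U) (w : V) {z : V} (hz : z ∈ U) (k : ℕ) :
    ‖iteratedFDeriv ℝ k (fun y => fderiv ℝ G y w) z‖ ≤ ‖w‖ * ‖iteratedFDeriv ℝ (k + 1) G z‖ := by
  have hGz : ContDiffAt ℝ ∞ G z := hG.contDiffAt (hU.mem_nhds hz)
  have hf : ContDiffAt ℝ k (fderiv ℝ G) z := hGz.fderiv_right (by exact_mod_cast le_top)
  calc ‖iteratedFDeriv ℝ k (fun y => fderiv ℝ G y w) z‖ ≤ ‖w‖ * ‖iteratedFDeriv ℝ k (fderiv ℝ G) z‖ := norm_iteratedFDeriv_clm_apply_const hf le_rfl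
    _ = ‖w‖ * ‖iteratedFDeriv ℝ (k + 1) G z‖ := by rw [norm_iteratedFDeriv_fderiv]

variable {P M : Type*} [NormedAddCommGroup P] [NormedSpace ℝ P] [NormedAddCommGroup M] [NormedSpace ℝ M]

/-- **Joint jet bounds pass to the parameter-derivative family**: on the open `O ×ˢ univ`, `‖Dᵏ (uncurry (q ↦ X ↦ ∂_v (q′ ↦ g q′ X) q)) z‖ ≤ ‖v‖ · ‖Dᵏ⁺¹ (uncurry g) z‖` (the
parameter derivative is the total derivative on `(v, 0)`, ★ `fderiv_slice_fst_apply_of_prod`; then the evaluation CLM against the next jet, Mathlib `norm_iteratedFDeriv_clm_apply_const` +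
`norm_iteratedFDeriv_fderiv`) — the joint-bound half of the closure of the admissible class under parameter derivatives. [cite: HormanderALPDO1, §1.1 Thm. 1.1.8] -/
theorem norm_iteratedFDeriv_uncurry_fderiv_apply_le {g : P → M → F} {O : Set P} (hO : IsOpen O) (hg : ContDiffOn ℝ ∞ (uncurry g) (O ×ˢ univ)) (v : P)
    {z : P × M} (hz : z ∈ O ×ˢ (univ : Set M)) (k : ℕ) :
    ‖iteratedFDeriv ℝ k (uncurry fun q X => fderiv ℝ (fun q' => g q' X) q v) z‖ ≤ ‖v‖ * ‖iteratedFDeriv ℝ (k + 1) (uncurry g) z‖ := by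
  have hU : IsOpen (O ×ˢ (univ : Set M)) := hO.prod isOpen_univ
  have hev : (uncurry fun q X => fderiv ℝ (fun q' => g q' X) q v) =ᶠ[𝓝 z] fun y => fderiv ℝ (uncurry g) y ((v, 0) : P × M) := by
    filter_upwards [hU.mem_nhds hz] with y hy
    have hd : DifferentiableAt ℝ (uncurry g) y := (hg.contDiffAt (hU.mem_nhds hy)).differentiableAt (by simp)
    exact fderiv_slice_fst_apply_of_prod hd v
  rw [(hev.iteratedFDeriv ℝ k).eq_of_nhds]
  refine (norm_iteratedFDeriv_fderiv_apply_le_aux hU hg ((v, 0) : P × M) hz k).trans ?_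
  have hn : ‖((v, 0) : P × M)‖ = ‖v‖ := by rw [Prod.norm_mk, norm_zero, max_eq_left (norm_nonneg v)]
  rw [hn]

end Generic

/-! ## §2 THE PEELING INDUCTION -/

section Peeling

variable {M E : Type} [NormedAddCommGroup M] [NormedSpace ℝ M] [FiniteDimensional ℝ M] [NormedAddCommGroup E] [NormedSpace ℝ E]

/-- **THE PEELING INDUCTION — an `m`-fold nested reader of a jointly smooth, compactly supported block function is smooth off the `m` walls, with every jet bounded on
`K ×ˢ (T ∩ T₀)^m`.**  Data: a functional `Φ : (M → E) → ℝ → E` with (ELL-∞-UNIF) on the fixed set `T ∩ T₀` at every `ℓ^∞(J, E)` (`hunif`) and reader data on open parameter sets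
(`hread`: smoothness of `z ↦ Φ (g z.1) z.2` on `O ×ˢ T` and `∂_{(v,0)}` = reader of the parameter derivative, for families smooth on `O ×ˢ univ` with one compact support); a tower
`H m P′ : (P′ × (Fin m → M) → E) → (P′ × (Fin m → ℝ) → E)` with `H 0 f (q, ·) = f (q, ·)` (`hH0`), the PEELING identity `H (m+1) f (q, ψ) = Φ (X₀ ↦ H m f̃ ((q, X₀), Fin.tail ψ)) (ψ 0)`,
`f̃ ((q, X₀), X′) = f (q, Fin.cons X₀ X′)` for `f` smooth on `Q ×ˢ univ` with one compact block support, `q ∈ Q`, `ψ ∈ T^{m+1}` (`hHsucc` — there the `Measure.pi` Fubini holds), and `H m f (q, ψ) = 0` when `f (q, ·) ≡ 0` (`hHzero`).  Conclusion, for every `m`, every finite-dimensional `P`, open `Q ⊆ P`,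
`f` smooth on `Q ×ˢ univ` with `f (q, X) = 0` as soon as some `X k ∉ C` (`C` compact), and compact `K ⊆ Q`:
`ContDiffOn ℝ ∞ (H m P f) (Q ×ˢ (univ.pi fun _ => T))` and `∀ n, ∃ B, ∀ z ∈ K ×ˢ (univ.pi fun _ => T ∩ T₀), ‖iteratedFDeriv ℝ n (H m P f) z‖ ≤ B`.
Induction on `m` with the parameter space growing by one block factor; the step is ★ (X3-CORE) §1 over the admissible class «smooth on `O ×ˢ univ`, one compact support, jointly bounded jets
on `(S ∩ O) ×ˢ univ`» (`O = Q ×ˢ T^m`, `S = K ×ˢ T₀^m`), whose `hbd` is ★ §2 ∘ ★ §3, followed by the linear re-indexing `(q, ψ) ↦ ((q, Fin.tail ψ), ψ 0)`.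
[cite: Varadarajan1977, Part I §1.12] [cite: Bouaziz1994IntegralesOrbitales, §3.1 (I₁)–(I₂) p. 579; §3.2 p. 580] [cite: HormanderALPDO1, §1.1 Thm. 1.1.8, (1.1.9); §2.1] -/
theorem contDiffOn_and_forall_bound_nestedReader (Φ : (M → E) → ℝ → E) {T : Set ℝ} (hT : IsOpen T) (T₀ : Set ℝ)
    (hunif : ∀ (J : Type) (Gf : M → lp (fun _ : J => E) ⊤), ContDiff ℝ ∞ Gf → HasCompactSupport Gf → ∀ n : ℕ,
      ∃ B : ℝ, ∀ ψ ∈ T ∩ T₀, ∀ ℓ : lp (fun _ : J => E) ⊤ →L[ℝ] E, ‖iteratedDeriv n (Φ (fun X => ℓ (Gf X))) ψ‖ ≤ ‖ℓ‖ * B)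
    (hread : ∀ (P' : Type) [NormedAddCommGroup P'] [NormedSpace ℝ P'] [FiniteDimensional ℝ P'] (O : Set P'), IsOpen O → ∀ g : P' → M → E,
      ContDiffOn ℝ ∞ (uncurry g) (O ×ˢ univ) → (∃ C : Set M, IsCompact C ∧ ∀ q ∈ O, ∀ X, X ∉ C → g q X = 0) →
        ContDiffOn ℝ ∞ (fun z : P' × ℝ => Φ (g z.1) z.2) (O ×ˢ T) ∧
        ∀ (v : P') (z : P' × ℝ), z ∈ O ×ˢ T → fderiv ℝ (fun z : P' × ℝ => Φ (g z.1) z.2) z (v, 0) = Φ (fun X => fderiv ℝ (fun q' => g q' X) z.1 v) z.2)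
    (H : ∀ (m : ℕ) (P' : Type), (P' × (Fin m → M) → E) → (P' × (Fin m → ℝ) → E))
    (hH0 : ∀ (P' : Type) (f : P' × (Fin 0 → M) → E) (q : P') (ψ : Fin 0 → ℝ), H 0 P' f (q, ψ) = f (q, fun k => k.elim0))
    (hHsucc : ∀ (m : ℕ) (P' : Type) [NormedAddCommGroup P'] [NormedSpace ℝ P'] (Q : Set P'), IsOpen Q → ∀ (f : P' × (Fin (m + 1) → M) → E),
      ContDiffOn ℝ ∞ f (Q ×ˢ univ) → (∃ C : Set M, IsCompact C ∧ ∀ (q : P') (X : Fin (m + 1) → M), (∃ k, X k ∉ C) → f (q, X) = 0) →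
      ∀ q ∈ Q, ∀ ψ : Fin (m + 1) → ℝ, (∀ k, ψ k ∈ T) →
        H (m + 1) P' f (q, ψ) = Φ (fun X₀ => H m (P' × M) (fun p => f (p.1.1, Fin.cons p.1.2 p.2)) ((q, X₀), Fin.tail ψ)) (ψ 0))
    (hHzero : ∀ (m : ℕ) (P' : Type) (f : P' × (Fin m → M) → E) (q : P') (ψ : Fin m → ℝ), (∀ X, f (q, X) = 0) → H m P' f (q, ψ) = 0)
    (m : ℕ) :
    ∀ (P : Type) [NormedAddCommGroup P] [NormedSpace ℝ P] [FiniteDimensional ℝ P] (Q : Set P), IsOpen Q →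
      ∀ (f : P × (Fin m → M) → E), ContDiffOn ℝ ∞ f (Q ×ˢ univ) → ∀ (C : Set M), IsCompact C → (∀ (q : P) (X : Fin m → M), (∃ k, X k ∉ C) → f (q, X) = 0) →
        ∀ (K : Set P), IsCompact K → K ⊆ Q →
          ContDiffOn ℝ ∞ (H m P f) (Q ×ˢ Set.pi univ fun _ => T) ∧
            ∀ n : ℕ, ∃ B : ℝ, ∀ z ∈ K ×ˢ Set.pi univ (fun _ => T ∩ T₀), ‖iteratedFDeriv ℝ n (H m P f) z‖ ≤ B := by
  induction m with
  | zero =>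
    intro P _ _ _ Q hQ f hf C hC hfC K hK hKQ
    -- `H 0 P f = f ∘ (z ↦ (z.1, elim0))`
    have hH : H 0 P f = fun z => f (z.1, fun k => k.elim0) := funext fun z => by rw [← hH0 P f z.1 z.2]
    have hι : ContDiff ℝ ∞ fun z : P × (Fin 0 → ℝ) => ((z.1, fun k : Fin 0 => (k.elim0 : M)) : P × (Fin 0 → M)) := contDiff_fst.prodMk contDiff_const
    have hmaps : MapsTo (fun z : P × (Fin 0 → ℝ) => ((z.1, fun k : Fin 0 => (k.elim0 : M)) : P × (Fin 0 → M))) (Q ×ˢ univ) (Q ×ˢ univ) :=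
      fun z hz => ⟨hz.1, mem_univ _⟩
    have hsm : ContDiffOn ℝ ∞ (H 0 P f) (Q ×ˢ (univ : Set (Fin 0 → ℝ))) := by
      rw [hH]; exact hf.comp hι.contDiffOn hmaps
    have hpi : (Set.pi univ fun _ : Fin 0 => T) = univ := by ext ψ; simp
    refine ⟨by rw [hpi]; exact hsm, fun n => ?_⟩
    -- jets continuous on the open `Q ×ˢ univ`, bounded on the compact `K ×ˢ univ`
    have hO : IsOpen (Q ×ˢ (univ : Set (Fin 0 → ℝ))) := hQ.prod isOpen_univ
    have hcont : ContinuousOn (fun z => ‖iteratedFDeriv ℝ n (H 0 P f) z‖) (Q ×ˢ (univ : Set (Fin 0 → ℝ))) :=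
      ((hsm.continuousOn_iteratedFDerivWithin (m := n) (mod_cast le_top) hO.uniqueDiffOn).congr
        fun z hz => (iteratedFDerivWithin_of_isOpen n hO hz).symm).norm
    have hKc : IsCompact (K ×ˢ (univ : Set (Fin 0 → ℝ))) := hK.prod (Set.subsingleton_univ.isCompact)
    obtain ⟨B, hB⟩ := hKc.exists_bound_of_continuousOn (hcont.mono (prod_mono hKQ le_rfl))
    refine ⟨B, fun z hz => ?_⟩
    have h := hB z ⟨hz.1, mem_univ _⟩
    rw [Real.norm_eq_abs, abs_norm] at h
    exact h
  | succ m ih =>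
    intro P _ _ _ Q hQ f hf C hC hfC K hK hKQ
    -- the peeled data: parameters `P × M`, `f̃ ((q, X₀), X′) = f (q, Fin.cons X₀ X′)`
    set ft : (P × M) × (Fin m → M) → E := fun p => f (p.1.1, Fin.cons p.1.2 p.2) with hft
    have hQt : IsOpen (Q ×ˢ (univ : Set M)) := hQ.prod isOpen_univ
    have hcons : ContDiff ℝ ∞ fun p : (P × M) × (Fin m → M) => ((p.1.1, Fin.cons p.1.2 p.2) : P × (Fin (m + 1) → M)) := by
      refine (contDiff_fst.comp contDiff_fst).prodMk ?_
      have h : (fun p : (P × M) × (Fin m → M) => (Fin.cons p.1.2 p.2 : Fin (m + 1) → M)) =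
          (Fin.consEquivL ℝ (fun _ : Fin (m + 1) => M)) ∘ fun p : (P × M) × (Fin m → M) => (p.1.2, p.2) := by
        funext p; rfl
      rw [h]
      exact (Fin.consEquivL ℝ (fun _ : Fin (m + 1) => M)).contDiff.comp ((contDiff_snd.comp contDiff_fst).prodMk contDiff_snd)
    have hft_s : ContDiffOn ℝ ∞ ft ((Q ×ˢ (univ : Set M)) ×ˢ univ) :=
      hf.comp hcons.contDiffOn fun p hp => ⟨hp.1.1, mem_univ _⟩
    have hft_C : ∀ (p : P × M) (X' : Fin m → M), (∃ k, X' k ∉ C) → ft (p, X') = 0 := by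
      rintro p X' ⟨k, hk⟩
      exact hfC p.1 _ ⟨k.succ, by rwa [Fin.cons_succ]⟩
    have hft_0 : ∀ (p : P × M), p.2 ∉ C → ∀ X', ft (p, X') = 0 := fun p hp X' => hfC p.1 _ ⟨0, by rwa [Fin.cons_zero]⟩
    -- induction hypothesis at `P × M`, compact `K ×ˢ C`
    obtain ⟨hsm_m, hbd_m⟩ := ih (P × M) (Q ×ˢ univ) hQt ft hft_s C hC hft_C (K ×ˢ C) (hK.prod hC) (prod_mono hKQ (subset_univ _))
    -- the outer family over the open parameter set `O = Q ×ˢ T^m`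
    set O : Set (P × (Fin m → ℝ)) := Q ×ˢ Set.pi univ fun _ => T with hOdef
    have hOo : IsOpen O := hQ.prod (isOpen_set_pi finite_univ fun _ _ => hT)
    set g : P × (Fin m → ℝ) → M → E := fun q' X₀ => H m (P × M) ft ((q'.1, X₀), q'.2) with hgdef
    -- the shuffle `((q, ψ′), X₀) ↦ ((q, X₀), ψ′)` as a CLM
    set σ : (P × (Fin m → ℝ)) × M →L[ℝ] (P × M) × (Fin m → ℝ) :=
      (((ContinuousLinearMap.fst ℝ P (Fin m → ℝ)).comp (ContinuousLinearMap.fst ℝ _ M)).prod (ContinuousLinearMap.snd ℝ _ M)).prod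
        ((ContinuousLinearMap.snd ℝ P (Fin m → ℝ)).comp (ContinuousLinearMap.fst ℝ _ M)) with hσdef
    have hσ : ∀ z : (P × (Fin m → ℝ)) × M, σ z = ((z.1.1, z.2), z.1.2) := fun z => rfl
    have hug : uncurry g = (H m (P × M) ft) ∘ σ := funext fun z => by simp only [uncurry, hgdef, comp_apply, hσ]
    have hσmaps : MapsTo σ (O ×ˢ (univ : Set M)) ((Q ×ˢ univ) ×ˢ Set.pi univ fun _ => T) := fun z hz => by
      rw [hσ]; exact ⟨⟨hz.1.1, mem_univ _⟩, hz.1.2⟩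
    have hg_s : ContDiffOn ℝ ∞ (uncurry g) (O ×ˢ univ) := by rw [hug]; exact hsm_m.comp σ.contDiff.contDiffOn hσmaps
    have hg_C : ∀ q' ∈ O, ∀ X₀, X₀ ∉ C → g q' X₀ = 0 := fun q' _ X₀ hX₀ => hHzero m (P × M) ft (q'.1, X₀) q'.2 (hft_0 (q'.1, X₀) hX₀)
    obtain ⟨h1g, -⟩ := hread (P × (Fin m → ℝ)) O hOo g hg_s ⟨C, hC, hg_C⟩
    -- the re-indexing `Λ (q, ψ) = ((q, Fin.tail ψ), ψ 0)` and `H (m+1) P f = reader ∘ Λ`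
    set Λ : P × (Fin (m + 1) → ℝ) →L[ℝ] (P × (Fin m → ℝ)) × ℝ :=
      ((ContinuousLinearMap.fst ℝ P (Fin (m + 1) → ℝ)).prod
          ((ContinuousLinearMap.pi fun j : Fin m => ContinuousLinearMap.proj (R := ℝ) (φ := fun _ : Fin (m + 1) => ℝ) j.succ).comp
            (ContinuousLinearMap.snd ℝ P (Fin (m + 1) → ℝ)))).prod
        ((ContinuousLinearMap.proj (R := ℝ) (φ := fun _ : Fin (m + 1) => ℝ) 0).comp (ContinuousLinearMap.snd ℝ P (Fin (m + 1) → ℝ))) with hΛdef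
    have hΛ : ∀ z : P × (Fin (m + 1) → ℝ), Λ z = ((z.1, Fin.tail z.2), z.2 0) := fun z => rfl
    set R : (P × (Fin m → ℝ)) × ℝ → E := fun z => Φ (g z.1) z.2 with hRdef
    have hQT : IsOpen (Q ×ˢ Set.pi univ fun _ : Fin (m + 1) => T) := hQ.prod (isOpen_set_pi finite_univ fun _ _ => hT)
    have hHR : ∀ z ∈ Q ×ˢ Set.pi univ (fun _ : Fin (m + 1) => T), H (m + 1) P f z = (R ∘ Λ) z := fun z hz => by
      rw [comp_apply, hΛ, hRdef]
      simp only [hgdef]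
      rw [← hHsucc m P Q hQ f hf ⟨C, hC, hfC⟩ z.1 hz.1 z.2 fun k => hz.2 k (mem_univ _)]
    have hΛmaps : MapsTo Λ (Q ×ˢ Set.pi univ fun _ : Fin (m + 1) => T) (O ×ˢ T) := fun z hz => by
      rw [hΛ]
      exact ⟨⟨hz.1, fun j _ => hz.2 j.succ (mem_univ _)⟩, hz.2 0 (mem_univ _)⟩
    refine ⟨(h1g.comp Λ.contDiff.contDiffOn hΛmaps).congr hHR, fun n => ?_⟩
    -- the admissible class over `(O, S)`, `S = K ×ˢ T₀^m`
    set S : Set (P × (Fin m → ℝ)) := K ×ˢ Set.pi univ fun _ => T₀ with hSdef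
    set Adm : (P × (Fin m → ℝ) → M → E) → Prop := fun g' =>
      ContDiffOn ℝ ∞ (uncurry g') (O ×ˢ univ) ∧ (∃ C' : Set M, IsCompact C' ∧ ∀ q ∈ O, ∀ X, X ∉ C' → g' q X = 0) ∧
        ∀ k : ℕ, ∃ B : ℝ, ∀ q ∈ S ∩ O, ∀ X : M, ‖iteratedFDeriv ℝ k (uncurry g') (q, X)‖ ≤ B with hAdmdef
    set D : (P × (Fin m → ℝ)) → (P × (Fin m → ℝ) → M → E) → (P × (Fin m → ℝ) → M → E) := fun v g' q X => fderiv ℝ (fun q'' => g' q'' X) q v with hDdef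
    have hcl : ∀ g', Adm g' → ∀ v, Adm (D v g') := by
      rintro g' ⟨hs, ⟨C', hC', h0⟩, hb⟩ v
      refine ⟨contDiffOn_uncurry_fderiv_apply_of_isOpen hOo hs v, ⟨C', hC', fun q hq X hX => fderiv_apply_eq_zero_of_forall_mem_isOpen hOo (fun q' hq' => h0 q' hq' X hX) hq v⟩, fun k => ?_⟩
      obtain ⟨B, hB⟩ := hb (k + 1)
      exact ⟨‖v‖ * B, fun q hq X => (norm_iteratedFDeriv_uncurry_fderiv_apply_le hOo hs v ⟨hq.2, mem_univ X⟩ k).trans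
        (mul_le_mul_of_nonneg_left (hB q hq X) (norm_nonneg v))⟩
    have h1 : ∀ g', Adm g' → ContDiffOn ℝ ∞ (fun z : (P × (Fin m → ℝ)) × ℝ => Φ (g' z.1) z.2) (O ×ˢ T) := fun g' hg' => (hread _ O hOo g' hg'.1 hg'.2.1).1
    have h2 : ∀ g', Adm g' → ∀ (v : P × (Fin m → ℝ)) (z : (P × (Fin m → ℝ)) × ℝ), z ∈ O ×ˢ T →
        fderiv ℝ (fun z : (P × (Fin m → ℝ)) × ℝ => Φ (g' z.1) z.2) z (v, 0) = Φ (D v g' z.1) z.2 := fun g' hg' v z hz => (hread _ O hOo g' hg'.1 hg'.2.1).2 v z hz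
    -- `hbd`: members of an admissible family over `S ∩ O` are a `C^∞`-bounded family (★ §3), hence ★ §2 with `hunif` at `J = ↥(S ∩ O)`
    have hbd : ∀ g', Adm g' → ∀ a : ℕ, ∃ B : ℝ, ∀ q ∈ S ∩ O, ∀ ψ ∈ T ∩ (T ∩ T₀), ‖iteratedDeriv a (Φ (g' q)) ψ‖ ≤ B := by
      rintro g' ⟨hs, ⟨C', hC', h0⟩, hb⟩ a
      have hsl : ∀ q ∈ S ∩ O, ContDiff ℝ ∞ (g' q) := fun q hq => contDiff_slice_of_contDiffOn_prod_univ (uncurry g') hs hq.2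
      have hsupp : ∀ q ∈ S ∩ O, tsupport (g' q) ⊆ C' := fun q hq => tsupport_slice_subset (uncurry g') hC'.isClosed fun X hX => h0 q hq.2 X hX
      have hbd' : ∀ k : ℕ, ∃ B : ℝ, ∀ q ∈ S ∩ O, ∀ X ∈ C', ‖iteratedFDeriv ℝ k (g' q) X‖ ≤ B := fun k => by
        obtain ⟨B, hB⟩ := hb k
        exact ⟨B, fun q hq X _ => (norm_iteratedFDeriv_slice_le_of_isOpen (uncurry g') (hOo.prod isOpen_univ) (hs.of_le (mod_cast le_top)) ⟨hq.2, mem_univ X⟩).trans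
          (hB q hq X)⟩
      obtain ⟨B, hB⟩ := exists_forall_norm_iteratedDeriv_le_of_uniform_bounds_on_inter Φ a S O (T ∩ T₀)
        (fun Gf hGf hGfc => hunif (↥(S ∩ O)) Gf hGf hGfc a) g' hsl hC' hsupp hbd'
      exact ⟨B, fun q hq ψ hψ => hB q hq ψ hψ.2⟩
    -- our `g` is admissible: jointly bounded jets from the induction hypothesis (inside `C`) and vanishing (outside `C`)
    have hg_adm : Adm g := by
      refine ⟨hg_s, ⟨C, hC, hg_C⟩, fun k => ?_⟩
      obtain ⟨B, hB⟩ := hbd_m k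
      refine ⟨max (‖σ‖ ^ k * B) 0, fun q' hq' X₀ => ?_⟩
      by_cases hX₀ : X₀ ∈ C
      · have hOt : IsOpen ((Q ×ˢ (univ : Set M)) ×ˢ Set.pi univ fun _ : Fin m => T) := hQt.prod (isOpen_set_pi finite_univ fun _ _ => hT)
        have hz : σ (q', X₀) ∈ (Q ×ˢ (univ : Set M)) ×ˢ Set.pi univ fun _ : Fin m => T := hσmaps ⟨hq'.2, mem_univ _⟩
        have hle := norm_iteratedFDeriv_comp_clm_le_of_isOpen σ hOt (hsm_m.of_le (mod_cast le_top)) (n := k) hz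
        rw [← hug] at hle
        refine hle.trans ((mul_le_mul_of_nonneg_left (hB _ ?_) (pow_nonneg (norm_nonneg _) _)).trans (le_max_left _ _))
        rw [hσ]
        exact ⟨⟨hq'.1.1, hX₀⟩, fun j _ => ⟨hq'.2.2 j (mem_univ _), hq'.1.2 j (mem_univ _)⟩⟩
      · have hev : uncurry g =ᶠ[𝓝 (q', X₀)] fun _ => 0 := by
          have hopen : IsOpen {z : (P × (Fin m → ℝ)) × M | z.2 ∈ Cᶜ} := hC.isClosed.isOpen_compl.preimage continuous_snd
          filter_upwards [hopen.mem_nhds (show (q', X₀) ∈ {z : (P × (Fin m → ℝ)) × M | z.2 ∈ Cᶜ} from hX₀)] with z hz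
          exact hHzero m (P × M) ft (z.1.1, z.2) z.1.2 (hft_0 (z.1.1, z.2) hz)
        rw [iteratedFDeriv_eq_zero_of_eventuallyEq_zero hev k, norm_zero]
        exact le_max_right _ _
    -- ★ (X3-CORE) §1 on the product region `(S ∩ O) ×ˢ (T ∩ T₀)`, then pull back along `Λ`
    obtain ⟨B, hB⟩ := exists_forall_norm_iteratedFDeriv_lineReader_le_of_uniform_on hOo hT Φ Adm D hcl h1 h2 S (T ∩ T₀) hbd g hg_adm n
    have hOT : IsOpen (O ×ˢ T) := hOo.prod hT
    refine ⟨‖Λ‖ ^ n * max B 0, fun z hz => ?_⟩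
    have hzQ : z ∈ Q ×ˢ Set.pi univ (fun _ : Fin (m + 1) => T) := ⟨hKQ hz.1, fun j _ => (hz.2 j (mem_univ _)).1⟩
    have hzΛ : Λ z ∈ O ×ˢ T := hΛmaps hzQ
    have hle := norm_iteratedFDeriv_comp_clm_le_of_isOpen Λ hOT ((h1 g hg_adm).of_le (mod_cast le_top)) (n := n) hzΛ
    have hev : (R ∘ Λ) =ᶠ[𝓝 z] H (m + 1) P f := Filter.eventuallyEq_of_mem (hQT.mem_nhds hzQ) fun y hy => (hHR y hy).symm
    rw [(hev.iteratedFDeriv ℝ n).eq_of_nhds] at hle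
    refine hle.trans (mul_le_mul_of_nonneg_left ((hB _ ?_).trans (le_max_left _ _)) (pow_nonneg (norm_nonneg _) _))
    rw [hΛ]
    exact ⟨⟨⟨hz.1, fun j _ => (hz.2 j.succ (mem_univ _)).2⟩, ⟨hKQ hz.1, fun j _ => (hz.2 j.succ (mem_univ _)).1⟩⟩, (hz.2 0 (mem_univ _)).1, hz.2 0 (mem_univ _)⟩

end Peeling

end Literature.Analysis.Calculus

end
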